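import Summits.QuantumFields.YangMills.Theorems.AllWindowsColdBoxBoxHighLineStep2Defs
import Summits.QuantumFields.YangMills.Theorems.AllWindowsColdBoxBoxHighLineHodgePoincareStub

/-!
# T-S5.6 input: the Hodge–Poincaré floor of the chart Gaussian `boxQuadForm H a = Σ_c a^c·hodgeQ·a^c`
# (STUB-PLAN-S5-STEP2 §5 T-S5.6 `SmallFieldInsideFP` — the Gaussian-tail / far-region exponent; LINE-19 S5 ⟨stmt-QuantumFields-24004⟩/⟨24335⟩, LINE-20 U5 ⟨24336⟩;
# objects from ✓`…Step2Defs` BY NAME)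

Width seat `ym-line-sfw-p2-w4` (prover-ym-line-sfw-p2-w4-g27-0).  ✓S1 `hodgePoincare_explicit` (`(v·v)/(344H²) ≤ vᵀ·hodgeQ H·v`, `…HodgePoincareStub`) colour by
colour:
* `sum_norm_sq_eq_sum_colour` — `Σ_e ‖a e‖² = Σ_c (colour a c) ⬝ᵥ (colour a c)`;
* `boxQuadForm_nonneg`; **`sum_norm_sq_le_boxQuadForm`** — `Σ_e ‖a e‖² ≤ 344·H²·boxQuadForm H a` (`H ≥ 1`);
* **`sq_le_boxQuadForm_of_not_smallField`** — off `smallField H s` (`0 ≤ s`): `s² ≤ 344·H²·boxQuadForm H a`, i.e. the exponent `β·boxQuadForm ≥ β s²/(344H²)`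
  that the OUTER region of T-S5.6 pays (to be combined with the per-coordinate relative tails ✓`LaplaceSandwich.setIntegral_exists_coord_tail_le` and
  ✓S3a for the `C·H⁴·e^{−cβs²}` count).

Everything proved; no definitions; standard axioms.  HONEST LABEL: an S-sized input of the OPEN task T-S5.6 of STEP 2 of the XL stub S5 of a critic-PASSed DRAFT
line on the R2ξ″ cruxes; T-S5.6, S5, U5 and the items ⟨24004⟩ ⟨24335⟩ ⟨24336⟩ remain OPEN; no stub is closed by name, no crux, rung or summit is proved; the
Yang–Mills mass gap is NOT proved by this file.
-/

set_option autoImplicit false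

open Finset Matrix

namespace Summit.QuantumFields.YangMills.Theorems.AllWindowsColdBoxBoxHighLine

namespace BoxQuadForm

variable {H : ℕ}

/-- `‖a e‖² = Σ_c (a e c)²` for a vector of `E3`. -/
theorem norm_sq_eq_sum (v : E3) : ‖v‖ ^ 2 = ∑ c : Fin 3, v c ^ 2 := by
  have h : ‖v‖ ^ 2 = ∑ c : Fin 3, ‖v.ofLp c‖ ^ 2 := by
    rw [EuclideanSpace.norm_eq, Real.sq_sqrt (Finset.sum_nonneg fun c _ => sq_nonneg _)]
  rw [h]
  refine Finset.sum_congr rfl fun c _ => ?_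
  rw [Real.norm_eq_abs, sq_abs]

/-- **`Σ_e ‖a e‖² = Σ_c (colour a c)·(colour a c)`** (swap the edge and colour sums). -/
theorem sum_norm_sq_eq_sum_colour (a : LandauFree H → E3) :
    ∑ e, ‖a e‖ ^ 2 = ∑ c : Fin 3, colour a c ⬝ᵥ colour a c := by
  simp only [norm_sq_eq_sum]
  simp only [dotProduct, colour, sq]
  rw [Finset.sum_comm]

/-- `boxQuadForm` is non-negative (each colour form is `≥ (v·v)/(344H²) ≥ 0`; `H ≥ 1`). -/
theorem boxQuadForm_nonneg (hH : 1 ≤ H) (a : LandauFree H → E3) : 0 ≤ boxQuadForm H a := by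
  refine Finset.sum_nonneg fun c _ => ?_
  have h := hodgePoincare_explicit H hH (colour a c)
  have h0 : 0 ≤ colour a c ⬝ᵥ colour a c := Finset.sum_nonneg fun e _ => mul_self_nonneg _
  have hH' : (1 : ℝ) ≤ H := by exact_mod_cast hH
  exact le_trans (div_nonneg h0 (by positivity)) h

/-- **Hodge–Poincaré floor of the chart Gaussian**: `Σ_e ‖a e‖² ≤ 344·H²·boxQuadForm H a` (`H ≥ 1`). -/
theorem sum_norm_sq_le_boxQuadForm (hH : 1 ≤ H) (a : LandauFree H → E3) :
    ∑ e, ‖a e‖ ^ 2 ≤ 344 * (H : ℝ) ^ 2 * boxQuadForm H a := by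
  have hH' : (1 : ℝ) ≤ H := by exact_mod_cast hH
  have hpos : (0 : ℝ) < 344 * (H : ℝ) ^ 2 := by positivity
  rw [sum_norm_sq_eq_sum_colour, boxQuadForm, Finset.mul_sum]
  refine Finset.sum_le_sum fun c _ => ?_
  have h := hodgePoincare_explicit H hH (colour a c)
  rw [div_le_iff₀ hpos] at h
  linarith

/-- A single edge norm is controlled by the form: `‖a e‖² ≤ 344·H²·boxQuadForm H a`. -/
theorem norm_sq_le_boxQuadForm (hH : 1 ≤ H) (a : LandauFree H → E3) (e : LandauFree H) :
    ‖a e‖ ^ 2 ≤ 344 * (H : ℝ) ^ 2 * boxQuadForm H a := by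
  refine le_trans ?_ (sum_norm_sq_le_boxQuadForm hH a)
  rw [← Finset.add_sum_erase Finset.univ _ (Finset.mem_univ e)]
  exact le_add_of_nonneg_right (Finset.sum_nonneg fun e' _ => sq_nonneg _)

/-- **Off the small-field set the form is large**: `a ∉ smallField H s` (`0 ≤ s`) ⇒ `s² ≤ 344·H²·boxQuadForm H a`. -/
theorem sq_le_boxQuadForm_of_not_smallField (hH : 1 ≤ H) {s : ℝ} (hs : 0 ≤ s) {a : LandauFree H → E3} (ha : a ∉ smallField H s) :
    s ^ 2 ≤ 344 * (H : ℝ) ^ 2 * boxQuadForm H a := by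
  have h : ∃ e, s < ‖a e‖ := by
    by_contra hne
    push Not at hne
    exact ha hne
  obtain ⟨e, he⟩ := h
  exact le_trans (pow_le_pow_left₀ hs he.le 2) (norm_sq_le_boxQuadForm hH a e)

end BoxQuadForm

end Summit.QuantumFields.YangMills.Theorems.AllWindowsColdBoxBoxHighLine
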